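import Summits.ValiantsHypothesis.ValiantsHypothesis.Theorems.LacunarySymmetroidMatrixDescartesFiniteSectorSectorCeilingEightFive
import Summits.ValiantsHypothesis.ValiantsHypothesis.Theorems.LacunarySymmetroidMatrixDescartesFiniteSectorSectorCeilingEightFour
import Summits.ValiantsHypothesis.ValiantsHypothesis.Theorems.LacunarySymmetroidMatrixDescartesFiniteSectorSectorCeilingEighteenFour
import Summits.ValiantsHypothesis.ValiantsHypothesis.Theorems.LacunarySymmetroidMatrixDescartesFiniteSectorSectorCeilingElevenFive
import Summits.ValiantsHypothesis.ValiantsHypothesis.Theorems.LacunarySymmetroidMatrixDescartesFiniteSectorSectorCeilingElevenFour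
import Summits.ValiantsHypothesis.ValiantsHypothesis.Theorems.LacunarySymmetroidMatrixDescartesFiniteSectorSectorCeilingFifteenFour
import Summits.ValiantsHypothesis.ValiantsHypothesis.Theorems.LacunarySymmetroidMatrixDescartesFiniteSectorSectorCeilingFiveFive
import Summits.ValiantsHypothesis.ValiantsHypothesis.Theorems.LacunarySymmetroidMatrixDescartesFiniteSectorSectorCeilingFiveFour
import Summits.ValiantsHypothesis.ValiantsHypothesis.Theorems.LacunarySymmetroidMatrixDescartesFiniteSectorSectorCeilingFiveSix
import Summits.ValiantsHypothesis.ValiantsHypothesis.Theorems.LacunarySymmetroidMatrixDescartesFiniteSectorSectorCeilingFourFive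
import Summits.ValiantsHypothesis.ValiantsHypothesis.Theorems.LacunarySymmetroidMatrixDescartesFiniteSectorSectorCeilingFourFour
import Summits.ValiantsHypothesis.ValiantsHypothesis.Theorems.LacunarySymmetroidMatrixDescartesFiniteSectorSectorCeilingFourSix
import Summits.ValiantsHypothesis.ValiantsHypothesis.Theorems.LacunarySymmetroidMatrixDescartesFiniteSectorSectorCeilingFourteenFour
import Summits.ValiantsHypothesis.ValiantsHypothesis.Theorems.LacunarySymmetroidMatrixDescartesFiniteSectorSectorCeilingMTwo
import Summits.ValiantsHypothesis.ValiantsHypothesis.Theorems.LacunarySymmetroidMatrixDescartesFiniteSectorSectorCeilingMTwoKEight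
import Summits.ValiantsHypothesis.ValiantsHypothesis.Theorems.LacunarySymmetroidMatrixDescartesFiniteSectorSectorCeilingMTwoKFive
import Summits.ValiantsHypothesis.ValiantsHypothesis.Theorems.LacunarySymmetroidMatrixDescartesFiniteSectorSectorCeilingMTwoKNine
import Summits.ValiantsHypothesis.ValiantsHypothesis.Theorems.LacunarySymmetroidMatrixDescartesFiniteSectorSectorCeilingMTwoKSeven
import Summits.ValiantsHypothesis.ValiantsHypothesis.Theorems.LacunarySymmetroidMatrixDescartesFiniteSectorSectorCeilingMTwoKThreeFour
import Summits.ValiantsHypothesis.ValiantsHypothesis.Theorems.LacunarySymmetroidMatrixDescartesFiniteSectorSectorCeilingNineFive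
import Summits.ValiantsHypothesis.ValiantsHypothesis.Theorems.LacunarySymmetroidMatrixDescartesFiniteSectorSectorCeilingNineFour
import Summits.ValiantsHypothesis.ValiantsHypothesis.Theorems.LacunarySymmetroidMatrixDescartesFiniteSectorSectorCeilingNineteenFour
import Summits.ValiantsHypothesis.ValiantsHypothesis.Theorems.LacunarySymmetroidMatrixDescartesFiniteSectorSectorCeilingSevenFive
import Summits.ValiantsHypothesis.ValiantsHypothesis.Theorems.LacunarySymmetroidMatrixDescartesFiniteSectorSectorCeilingSevenFour
import Summits.ValiantsHypothesis.ValiantsHypothesis.Theorems.LacunarySymmetroidMatrixDescartesFiniteSectorSectorCeilingSeventeenFour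
import Summits.ValiantsHypothesis.ValiantsHypothesis.Theorems.LacunarySymmetroidMatrixDescartesFiniteSectorSectorCeilingSixFive
import Summits.ValiantsHypothesis.ValiantsHypothesis.Theorems.LacunarySymmetroidMatrixDescartesFiniteSectorSectorCeilingSixFour
import Summits.ValiantsHypothesis.ValiantsHypothesis.Theorems.LacunarySymmetroidMatrixDescartesFiniteSectorSectorCeilingSixSix
import Summits.ValiantsHypothesis.ValiantsHypothesis.Theorems.LacunarySymmetroidMatrixDescartesFiniteSectorSectorCeilingSixteenFour
import Summits.ValiantsHypothesis.ValiantsHypothesis.Theorems.LacunarySymmetroidMatrixDescartesFiniteSectorSectorCeilingTenFive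
import Summits.ValiantsHypothesis.ValiantsHypothesis.Theorems.LacunarySymmetroidMatrixDescartesFiniteSectorSectorCeilingTenFour
import Summits.ValiantsHypothesis.ValiantsHypothesis.Theorems.LacunarySymmetroidMatrixDescartesFiniteSectorSectorCeilingThirteenFour
import Summits.ValiantsHypothesis.ValiantsHypothesis.Theorems.LacunarySymmetroidMatrixDescartesFiniteSectorSectorCeilingThreeFive
import Summits.ValiantsHypothesis.ValiantsHypothesis.Theorems.LacunarySymmetroidMatrixDescartesFiniteSectorSectorCeilingThreeFour
import Summits.ValiantsHypothesis.ValiantsHypothesis.Theorems.LacunarySymmetroidMatrixDescartesFiniteSectorSectorCeilingThreeSix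
import Summits.ValiantsHypothesis.ValiantsHypothesis.Theorems.LacunarySymmetroidMatrixDescartesFiniteSectorSectorCeilingTwelveFour
import Summits.ValiantsHypothesis.ValiantsHypothesis.Theorems.LacunarySymmetroidMatrixDescartesFiniteSectorSectorCeilingTwentyFour
import Summits.ValiantsHypothesis.ValiantsHypothesis.Theorems.LacunarySymmetroidMatrixDescartesFiniteSectorSectorCeilingTwentyfiveFour
import Summits.ValiantsHypothesis.ValiantsHypothesis.Theorems.LacunarySymmetroidMatrixDescartesFiniteSectorSectorCeilingTwentyfourFour
import Summits.ValiantsHypothesis.ValiantsHypothesis.Theorems.LacunarySymmetroidMatrixDescartesFiniteSectorSectorCeilingTwentyoneFour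
import Summits.ValiantsHypothesis.ValiantsHypothesis.Theorems.LacunarySymmetroidMatrixDescartesFiniteSectorSectorCeilingTwentythreeFour
import Summits.ValiantsHypothesis.ValiantsHypothesis.Theorems.LacunarySymmetroidMatrixDescartesFiniteSectorSectorCeilingTwentytwoFour
import Summits.ValiantsHypothesis.ValiantsHypothesis.Theorems.LacunarySymmetroidMatrixDescartesFiniteSectorStampCeilingEightFive
import Summits.ValiantsHypothesis.ValiantsHypothesis.Theorems.LacunarySymmetroidMatrixDescartesFiniteSectorStampCeilingEightFour
import Summits.ValiantsHypothesis.ValiantsHypothesis.Theorems.LacunarySymmetroidMatrixDescartesFiniteSectorStampCeilingEightSix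
import Summits.ValiantsHypothesis.ValiantsHypothesis.Theorems.LacunarySymmetroidMatrixDescartesFiniteSectorStampCeilingEighteenFour
import Summits.ValiantsHypothesis.ValiantsHypothesis.Theorems.LacunarySymmetroidMatrixDescartesFiniteSectorStampCeilingElevenFive
import Summits.ValiantsHypothesis.ValiantsHypothesis.Theorems.LacunarySymmetroidMatrixDescartesFiniteSectorStampCeilingElevenFour
import Summits.ValiantsHypothesis.ValiantsHypothesis.Theorems.LacunarySymmetroidMatrixDescartesFiniteSectorStampCeilingFifteenFive
import Summits.ValiantsHypothesis.ValiantsHypothesis.Theorems.LacunarySymmetroidMatrixDescartesFiniteSectorStampCeilingFifteenFour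
import Summits.ValiantsHypothesis.ValiantsHypothesis.Theorems.LacunarySymmetroidMatrixDescartesFiniteSectorStampCeilingFiveFive
import Summits.ValiantsHypothesis.ValiantsHypothesis.Theorems.LacunarySymmetroidMatrixDescartesFiniteSectorStampCeilingFiveFour
import Summits.ValiantsHypothesis.ValiantsHypothesis.Theorems.LacunarySymmetroidMatrixDescartesFiniteSectorStampCeilingFiveSix
import Summits.ValiantsHypothesis.ValiantsHypothesis.Theorems.LacunarySymmetroidMatrixDescartesFiniteSectorStampCeilingFourFive
import Summits.ValiantsHypothesis.ValiantsHypothesis.Theorems.LacunarySymmetroidMatrixDescartesFiniteSectorStampCeilingFourFour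
import Summits.ValiantsHypothesis.ValiantsHypothesis.Theorems.LacunarySymmetroidMatrixDescartesFiniteSectorStampCeilingFourSix
import Summits.ValiantsHypothesis.ValiantsHypothesis.Theorems.LacunarySymmetroidMatrixDescartesFiniteSectorStampCeilingFourteenFive
import Summits.ValiantsHypothesis.ValiantsHypothesis.Theorems.LacunarySymmetroidMatrixDescartesFiniteSectorStampCeilingFourteenFour
import Summits.ValiantsHypothesis.ValiantsHypothesis.Theorems.LacunarySymmetroidMatrixDescartesFiniteSectorStampCeilingKThree
import Summits.ValiantsHypothesis.ValiantsHypothesis.Theorems.LacunarySymmetroidMatrixDescartesFiniteSectorStampCeilingMTwo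
import Summits.ValiantsHypothesis.ValiantsHypothesis.Theorems.LacunarySymmetroidMatrixDescartesFiniteSectorStampCeilingMTwoEleven
import Summits.ValiantsHypothesis.ValiantsHypothesis.Theorems.LacunarySymmetroidMatrixDescartesFiniteSectorStampCeilingMTwoHigh
import Summits.ValiantsHypothesis.ValiantsHypothesis.Theorems.LacunarySymmetroidMatrixDescartesFiniteSectorStampCeilingMTwoNine
import Summits.ValiantsHypothesis.ValiantsHypothesis.Theorems.LacunarySymmetroidMatrixDescartesFiniteSectorStampCeilingMTwoTen
import Summits.ValiantsHypothesis.ValiantsHypothesis.Theorems.LacunarySymmetroidMatrixDescartesFiniteSectorStampCeilingNineFive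
import Summits.ValiantsHypothesis.ValiantsHypothesis.Theorems.LacunarySymmetroidMatrixDescartesFiniteSectorStampCeilingNineFour
import Summits.ValiantsHypothesis.ValiantsHypothesis.Theorems.LacunarySymmetroidMatrixDescartesFiniteSectorStampCeilingNineteenFour
import Summits.ValiantsHypothesis.ValiantsHypothesis.Theorems.LacunarySymmetroidMatrixDescartesFiniteSectorStampCeilingSevenFive
import Summits.ValiantsHypothesis.ValiantsHypothesis.Theorems.LacunarySymmetroidMatrixDescartesFiniteSectorStampCeilingSevenFour
import Summits.ValiantsHypothesis.ValiantsHypothesis.Theorems.LacunarySymmetroidMatrixDescartesFiniteSectorStampCeilingSevenSix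
import Summits.ValiantsHypothesis.ValiantsHypothesis.Theorems.LacunarySymmetroidMatrixDescartesFiniteSectorStampCeilingSeventeenFour
import Summits.ValiantsHypothesis.ValiantsHypothesis.Theorems.LacunarySymmetroidMatrixDescartesFiniteSectorStampCeilingSixFive
import Summits.ValiantsHypothesis.ValiantsHypothesis.Theorems.LacunarySymmetroidMatrixDescartesFiniteSectorStampCeilingSixFour
import Summits.ValiantsHypothesis.ValiantsHypothesis.Theorems.LacunarySymmetroidMatrixDescartesFiniteSectorStampCeilingSixSix
import Summits.ValiantsHypothesis.ValiantsHypothesis.Theorems.LacunarySymmetroidMatrixDescartesFiniteSectorStampCeilingSixteenFour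
import Summits.ValiantsHypothesis.ValiantsHypothesis.Theorems.LacunarySymmetroidMatrixDescartesFiniteSectorStampCeilingTenFive
import Summits.ValiantsHypothesis.ValiantsHypothesis.Theorems.LacunarySymmetroidMatrixDescartesFiniteSectorStampCeilingTenFour
import Summits.ValiantsHypothesis.ValiantsHypothesis.Theorems.LacunarySymmetroidMatrixDescartesFiniteSectorStampCeilingThirteenFive
import Summits.ValiantsHypothesis.ValiantsHypothesis.Theorems.LacunarySymmetroidMatrixDescartesFiniteSectorStampCeilingThirteenFour
import Summits.ValiantsHypothesis.ValiantsHypothesis.Theorems.LacunarySymmetroidMatrixDescartesFiniteSectorStampCeilingThreeFive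
import Summits.ValiantsHypothesis.ValiantsHypothesis.Theorems.LacunarySymmetroidMatrixDescartesFiniteSectorStampCeilingThreeFour
import Summits.ValiantsHypothesis.ValiantsHypothesis.Theorems.LacunarySymmetroidMatrixDescartesFiniteSectorStampCeilingThreeSix
import Summits.ValiantsHypothesis.ValiantsHypothesis.Theorems.LacunarySymmetroidMatrixDescartesFiniteSectorStampCeilingTwelveFive
import Summits.ValiantsHypothesis.ValiantsHypothesis.Theorems.LacunarySymmetroidMatrixDescartesFiniteSectorStampCeilingTwelveFour
import Summits.ValiantsHypothesis.ValiantsHypothesis.Theorems.LacunarySymmetroidMatrixDescartesFiniteSectorStampCeilingTwentyFour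
import Summits.ValiantsHypothesis.ValiantsHypothesis.Theorems.LacunarySymmetroidMatrixDescartesFiniteSectorStampCeilingTwentyfiveFour
import Summits.ValiantsHypothesis.ValiantsHypothesis.Theorems.LacunarySymmetroidMatrixDescartesFiniteSectorStampCeilingTwentyfourFour
import Summits.ValiantsHypothesis.ValiantsHypothesis.Theorems.LacunarySymmetroidMatrixDescartesFiniteSectorStampCeilingTwentyoneFour
import Summits.ValiantsHypothesis.ValiantsHypothesis.Theorems.LacunarySymmetroidMatrixDescartesFiniteSectorStampCeilingTwentythreeFour
import Summits.ValiantsHypothesis.ValiantsHypothesis.Theorems.LacunarySymmetroidMatrixDescartesFiniteSectorStampCeilingTwentytwoFour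

/-!
# `MatrixDescartes` — line «finite»: THE KERNEL TABLE BY NAME — columns `K = 4, 5, 6` and the row `m = 2` of the finite registers as single theorems

HONEST FRAMING.  Object-search cell `pub-symmetroid`, seat val-sym-door-p5 g10.  HELPER of the crux item `stmt-ValiantsHypothesis-18050` with NO closure claim and no new
mathematics: each theorem below merely ASSEMBLES landed single-cell files of line «finite» (val-sym-door-p5 g7–g10, val-sym-eng-3) into one citeable statement per
column / row, `∀ m ∈ [lo, hi], Law m K (table[m])` by `interval_cases` + `exact`.  Upper sides only (`HypRootLawAt m K σ` = «η(m,K) ≤ σ», `StampLawAt m K n` =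
«ν(m,K) ≤ n»); every value is the located exact value of the sieve / postage-stamp enumeration and equals `2·n(m,K−1)` resp. `n(m,K−1)` (Conjecture Σ of `Lines/finite.md`,
RECORD tier); with `…FiniteSectorFormatMonotone` (p673153) each column bounds every smaller format.  The `K = 3` column is eng-3's all-`m` theorem
(`hypRootLawAt_K_three_all`, `…SigmaKThreeAll`) and is not repeated.  Nothing here bears on the crux (asymptotic in `K`), the doors, the ζ registers or `VP ≠ VNP`.
[folklore] Bookkeeping; no citation is load-bearing.
-/

-- `Summit.ValiantsHypothesis.ValiantsHypothesis.…` repeats a component by the D-0017 layout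
-- (single-conjunct summit), which the `dupNamespace` linter flags; the name is mandated.
set_option linter.dupNamespace false

namespace Summit.ValiantsHypothesis.ValiantsHypothesis.Theorems.LacunarySymmetroidMatrixDescartes.FiniteSector

/-- **The `K = 4` column, sector register, by name**: `η(m,4) ≤ σ(m,4) = 2·n(m,3)` for every `2 ≤ m ≤ 25` (values `16, 30, 52, 70, 104, 138, 178, 224, 292, 344, 424, 518, 604, 708, 836, 952, 1096, 1266, 1428, 1610, 1804, 2024, 2254, 2508` — the landed cells `hypRootLawAt_<m>_four_<σ>`). [folklore] -/
theorem hypRootLawAt_column_four (m : ℕ) (hm : 2 ≤ m) (hM : m ≤ 25) :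
    HypRootLawAt m 4 (([16, 30, 52, 70, 104, 138, 178, 224, 292, 344, 424, 518, 604, 708, 836, 952, 1096, 1266, 1428, 1610, 1804, 2024, 2254, 2508] : List ℕ).getD (m - 2) 0) := by
  interval_cases m
  · exact hypRootLawAt_two_four_16
  · exact hypRootLawAt_three_four_30
  · exact hypRootLawAt_four_four_52
  · exact hypRootLawAt_five_four_70
  · exact hypRootLawAt_six_four_104
  · exact hypRootLawAt_seven_four_138
  · exact hypRootLawAt_eight_four_178
  · exact hypRootLawAt_nine_four_224
  · exact hypRootLawAt_ten_four_292
  · exact hypRootLawAt_eleven_four_344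
  · exact hypRootLawAt_twelve_four_424
  · exact hypRootLawAt_thirteen_four_518
  · exact hypRootLawAt_fourteen_four_604
  · exact hypRootLawAt_fifteen_four_708
  · exact hypRootLawAt_sixteen_four_836
  · exact hypRootLawAt_seventeen_four_952
  · exact hypRootLawAt_eighteen_four_1096
  · exact hypRootLawAt_nineteen_four_1266
  · exact hypRootLawAt_twenty_four_1428
  · exact hypRootLawAt_twentyone_four_1610
  · exact hypRootLawAt_twentytwo_four_1804
  · exact hypRootLawAt_twentythree_four_2024
  · exact hypRootLawAt_twentyfour_four_2254
  · exact hypRootLawAt_twentyfive_four_2508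

/-- **The `K = 4` column, stamp register, by name**: `ν(m,4) ≤ n(m,3)` for every `2 ≤ m ≤ 25` (the classical three-denomination postage-stamp numbers `8, 15, 26, 35, 52, 69, 89, 112, 146, 172, 212, 259, 302, 354, 418, 476, 548, 633, 714, 805, 902, 1012, 1127, 1254`). [folklore] -/
theorem stampLawAt_column_four (m : ℕ) (hm : 2 ≤ m) (hM : m ≤ 25) :
    StampLawAt m 4 (([8, 15, 26, 35, 52, 69, 89, 112, 146, 172, 212, 259, 302, 354, 418, 476, 548, 633, 714, 805, 902, 1012, 1127, 1254] : List ℕ).getD (m - 2) 0) := by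
  interval_cases m
  · exact stampLawAt_two_four
  · exact stampLawAt_three_four
  · exact stampLawAt_four_four
  · exact stampLawAt_five_four
  · exact stampLawAt_six_four
  · exact stampLawAt_seven_four
  · exact stampLawAt_eight_four
  · exact stampLawAt_nine_four
  · exact stampLawAt_ten_four
  · exact stampLawAt_eleven_four
  · exact stampLawAt_twelve_four
  · exact stampLawAt_thirteen_four
  · exact stampLawAt_fourteen_four
  · exact stampLawAt_fifteen_four
  · exact stampLawAt_sixteen_four
  · exact stampLawAt_seventeen_four
  · exact stampLawAt_eighteen_four
  · exact stampLawAt_nineteen_four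
  · exact stampLawAt_twenty_four
  · exact stampLawAt_twentyone_four
  · exact stampLawAt_twentytwo_four
  · exact stampLawAt_twentythree_four
  · exact stampLawAt_twentyfour_four
  · exact stampLawAt_twentyfive_four

/-- **The `K = 5` column, sector register**: `η(m,5) ≤ 2·n(m,4)` for `2 ≤ m ≤ 11`. [folklore] -/
theorem hypRootLawAt_column_five (m : ℕ) (hm : 2 ≤ m) (hM : m ≤ 11) :
    HypRootLawAt m 5 (([24, 48, 88, 142, 228, 330, 468, 652, 854, 1094] : List ℕ).getD (m - 2) 0) := by
  interval_cases m
  · exact hypRootLawAt_two_five_24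
  · exact hypRootLawAt_three_five_48
  · exact hypRootLawAt_four_five_88
  · exact hypRootLawAt_five_five_142
  · exact hypRootLawAt_six_five_228
  · exact hypRootLawAt_seven_five_330
  · exact hypRootLawAt_eight_five_468
  · exact hypRootLawAt_nine_five_652
  · exact hypRootLawAt_ten_five_854
  · exact hypRootLawAt_eleven_five_1094

/-- **The `K = 5` column, stamp register**: `ν(m,5) ≤ n(m,4)` for `2 ≤ m ≤ 15`. [folklore] -/
theorem stampLawAt_column_five (m : ℕ) (hm : 2 ≤ m) (hM : m ≤ 15) :
    StampLawAt m 5 (([12, 24, 44, 71, 114, 165, 234, 326, 427, 547, 708, 873, 1094, 1383] : List ℕ).getD (m - 2) 0) := by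
  interval_cases m
  · exact stampLawAt_two_five
  · exact stampLawAt_three_five
  · exact stampLawAt_four_five
  · exact stampLawAt_five_five
  · exact stampLawAt_six_five
  · exact stampLawAt_seven_five
  · exact stampLawAt_eight_five
  · exact stampLawAt_nine_five
  · exact stampLawAt_ten_five
  · exact stampLawAt_eleven_five
  · exact stampLawAt_twelve_five
  · exact stampLawAt_thirteen_five
  · exact stampLawAt_fourteen_five
  · exact stampLawAt_fifteen_five

/-- **The `K = 6` column, sector register**: `η(m,6) ≤ 2·n(m,5)` for `2 ≤ m ≤ 6` (the door row `(2,6)`: `η(2,6) ≤ 32`). [folklore] -/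
theorem hypRootLawAt_column_six (m : ℕ) (hm : 2 ≤ m) (hM : m ≤ 6) :
    HypRootLawAt m 6 (([32, 72, 140, 252, 432] : List ℕ).getD (m - 2) 0) := by
  interval_cases m
  · exact hypRootLawAt_two_six_32
  · exact hypRootLawAt_three_six_72
  · exact hypRootLawAt_four_six_140
  · exact hypRootLawAt_five_six_252
  · exact hypRootLawAt_six_six_432

/-- **The `K = 6` column, stamp register**: `ν(m,6) ≤ n(m,5)` for `2 ≤ m ≤ 8`. [folklore] -/
theorem stampLawAt_column_six (m : ℕ) (hm : 2 ≤ m) (hM : m ≤ 8) :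
    StampLawAt m 6 (([16, 36, 70, 126, 216, 345, 512] : List ℕ).getD (m - 2) 0) := by
  interval_cases m
  · exact stampLawAt_two_six
  · exact stampLawAt_three_six
  · exact stampLawAt_four_six
  · exact stampLawAt_five_six
  · exact stampLawAt_six_six
  · exact stampLawAt_seven_six
  · exact stampLawAt_eight_six

/-- **The `m = 2` row, sector register**: `η(2,K) ≤ 2·n(2,K−1)` for `3 ≤ K ≤ 9` (`8, 16, 24, 32, 40, 52, 64`). [folklore] -/
theorem hypRootLawAt_row_two (K : ℕ) (hK : 3 ≤ K) (hKM : K ≤ 9) :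
    HypRootLawAt 2 K (([8, 16, 24, 32, 40, 52, 64] : List ℕ).getD (K - 3) 0) := by
  interval_cases K
  · exact hypRootLawAt_two_three_8
  · exact hypRootLawAt_two_four_16
  · exact hypRootLawAt_two_five_24
  · exact hypRootLawAt_two_six_32
  · exact hypRootLawAt_two_seven_40
  · exact hypRootLawAt_two_eight_52
  · exact hypRootLawAt_two_nine_64

/-- **The `m = 2` row, stamp register**: `ν(2,K) ≤ n(2,K−1)` for `3 ≤ K ≤ 11` (two-stamp postage numbers `4, 8, 12, 16, 20, 26, 32, 40, 46`, OEIS A001212). [folklore] -/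
theorem stampLawAt_row_two (K : ℕ) (hK : 3 ≤ K) (hKM : K ≤ 11) :
    StampLawAt 2 K (([4, 8, 12, 16, 20, 26, 32, 40, 46] : List ℕ).getD (K - 3) 0) := by
  interval_cases K
  · exact stampLawAt_two_three
  · exact stampLawAt_two_four
  · exact stampLawAt_two_five
  · exact stampLawAt_two_six
  · exact stampLawAt_two_seven
  · exact stampLawAt_two_eight
  · exact stampLawAt_two_nine
  · exact stampLawAt_two_ten
  · exact stampLawAt_two_eleven

end Summit.ValiantsHypothesis.ValiantsHypothesis.Theorems.LacunarySymmetroidMatrixDescartes.FiniteSector
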